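import Mathlib
import HarnessLib.Audit
import Summits.PneNP.PneNP.Theorems.PstarNorCore
import Summits.PneNP.PneNP.Theorems.PstarChordEndgameTools

/-!
# Tools for the NOR-core accounting lemma (ROUND-24, GAPTWO-PLAN v1 S4c): classes, centre degrees, boundary accounting

FRONTIER range-avoidance ladder, rung F-N3, ROUND 24 (cell `pnp-ideate`; restricted-model proof complexity — nothing here bears
on `P` versus `NP`).

Bookkeeping for the proof of `PstarNorCore.NorCoreBound` (planner memo `CORE-BOUND-NOTES.md` §5), organised so that NO path/component
decomposition of the centre graph is needed:

* boundary accounting: `card_varSet_inter_bdry_le` (an output with `t` identified non-private slots has at most `4 - t` private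
  variables) and `card_bdry_le_sum` (`#bdry X ≤ Σ_{j ∈ X} q j` for any per-output bounds `q`);
* the NOR setting: `xorPair`, centre edges `cen` (non-chords) and chords `chd`, the classes `cls σ` / `cls τ` (centre edges holding
  `σ` / `τ` in an AND slot) and the fourth variable `oth`; by simple overlaps with the reader `g₀` every centre edge lies in exactly one
  class (`mem_cls_or`, `not_mem_cls_both`), two edges of one class share no further variable (`cls_share`), so no XOR variable lies on
  three centre edges (`cdeg_le_two`);
* the handshake `sum_cdeg` / `two_mul_card_cen` (`2·#cen = η + 2ι`, `η`/`ι` = XOR variables of centre degree `1`/`2`) and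
  `iota_le` (`ι ≤ 2·#cls σ`).

The expansion counts built on these are in `PstarNorCoreCounts`.
-/

set_option linter.dupNamespace false

open Finset Literature.Computability.Complexity
open Summit.PneNP.PneNP.Theorems.PstarSALevel (varSet bdry BoundaryExpanding SimpleOverlap)
open Summit.PneNP.PneNP.Theorems.PstarGapLinearised (andPair andPair_subset_varSet)
open Summit.PneNP.PneNP.Theorems.PstarChordRepair (IsChord)
open Summit.PneNP.PneNP.Theorems.PstarCentreFree (vars_mem_varSet)
open Summit.PneNP.PneNP.Theorems.PstarGapOneKills (exists_other_reader mem_andPair_of_slot)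
open Summit.PneNP.PneNP.Theorems.PstarGapPeeling (not_mem_varSet_of_private)
open Summit.PneNP.PneNP.Theorems.PstarChordEndgameTools (not_two_shared mem_andPair_iff)
open Summit.PneNP.PneNP.Theorems.PstarCoreBound (XorClosed)
open Summit.PneNP.PneNP.Theorems.PstarNorCore (NorStructure)

namespace Summit.PneNP.PneNP.Theorems.PstarNorCoreTools

variable {n m : ℕ}

/-! ## Boundary accounting per output -/

/-- A variable read by two distinct members of `X` is not a boundary variable of `X`. -/
theorem not_mem_bdry_of_two (I : LocalMap 4 n m) {X : Finset (Fin m)} {j j' : Fin m} (hj : j ∈ X) (hj' : j' ∈ X) (hne : j ≠ j')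
    {v : Fin n} (hv : v ∈ varSet I j) (hv' : v ∈ varSet I j') : v ∉ bdry I X :=
  fun hb => not_mem_varSet_of_private I hj hj' hne.symm hb hv hv'

/-- An output with a set `N` of slots known to be non-private has at most `4 - #N` private variables. -/
theorem card_varSet_inter_bdry_le (I : LocalMap 4 n m) (X : Finset (Fin m)) (j : Fin m) (N : Finset (Fin 4))
    (hN : ∀ s ∈ N, I.vars j s ∉ bdry I X) : (varSet I j ∩ bdry I X).card ≤ 4 - N.card := by
  classical
  have hsub : varSet I j ∩ bdry I X ⊆ (univ \ N).image (I.vars j) := by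
    intro v hv
    rw [mem_inter] at hv
    obtain ⟨hvj, hvb⟩ := hv
    unfold PstarSALevel.varSet at hvj
    obtain ⟨s, -, rfl⟩ := mem_image.1 hvj
    exact mem_image.2 ⟨s, mem_sdiff.2 ⟨mem_univ _, fun hs => hN s hs hvb⟩, rfl⟩
  calc (varSet I j ∩ bdry I X).card ≤ ((univ \ N).image (I.vars j)).card := card_le_card hsub
    _ ≤ (univ \ N).card := card_image_le
    _ = 4 - N.card := by rw [card_univ_sdiff, Fintype.card_fin]

/-- **Boundary accounting**: the boundary of `X` is covered by the private parts of its members, so any per-output bounds add up. -/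
theorem card_bdry_le_sum (I : LocalMap 4 n m) (X : Finset (Fin m)) (q : Fin m → ℕ)
    (hq : ∀ j ∈ X, (varSet I j ∩ bdry I X).card ≤ q j) : (bdry I X).card ≤ ∑ j ∈ X, q j := by
  classical
  have hcov : bdry I X ⊆ X.biUnion fun j => varSet I j ∩ bdry I X := by
    intro v hv
    have hv' := hv
    unfold PstarSALevel.bdry at hv'
    rw [mem_filter, card_eq_one] at hv'
    obtain ⟨j, hj⟩ := hv'.2
    have hjm : j ∈ X.filter fun j => v ∈ varSet I j := by rw [hj]; exact mem_singleton_self j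
    rw [mem_filter] at hjm
    exact mem_biUnion.2 ⟨j, hjm.1, mem_inter.2 ⟨hjm.2, hv⟩⟩
  calc (bdry I X).card ≤ (X.biUnion fun j => varSet I j ∩ bdry I X).card := card_le_card hcov
    _ ≤ ∑ j ∈ X, (varSet I j ∩ bdry I X).card := card_biUnion_le
    _ ≤ ∑ j ∈ X, q j := sum_le_sum hq

/-- A boundary variable of `X` read by `j ∈ X` in some slot is read by no other member of `X` (in any slot). -/
theorem eq_of_mem_bdry (I : LocalMap 4 n m) {X : Finset (Fin m)} {j j' : Fin m} (hj : j ∈ X) (hj' : j' ∈ X) {v : Fin n}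
    (hb : v ∈ bdry I X) (hv : v ∈ varSet I j) (hv' : v ∈ varSet I j') : j = j' := by
  by_contra hne
  exact not_mem_bdry_of_two I hj hj' hne hv hv' hb

/-! ## The NOR setting: XOR pairs, centre edges, classes -/

/-- The XOR pair of an output. -/
def xorPair (I : LocalMap 4 n m) (f : Fin m) : Finset (Fin n) := {I.vars f 0, I.vars f 1}

/-- Membership in an XOR pair. -/
theorem mem_xorPair_iff (I : LocalMap 4 n m) (f : Fin m) (v : Fin n) : v ∈ xorPair I f ↔ v = I.vars f 0 ∨ v = I.vars f 1 := by
  unfold xorPair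
  rw [mem_insert, mem_singleton]

/-- The XOR pair lies in the variable set. -/
theorem xorPair_subset_varSet (I : LocalMap 4 n m) (f : Fin m) : xorPair I f ⊆ varSet I f := by
  intro v hv
  rw [mem_xorPair_iff] at hv
  rcases hv with rfl | rfl
  · exact vars_mem_varSet I f 0
  · exact vars_mem_varSet I f 1

/-- An XOR pair has at most two elements. -/
theorem card_xorPair_le (I : LocalMap 4 n m) (f : Fin m) : (xorPair I f).card ≤ 2 := by
  unfold xorPair
  exact (card_insert_le _ _).trans (by rw [card_singleton])

/-- On a pure instance the two XOR slots hold different variables. -/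
theorem vars_zero_ne_one (I : LocalMap 4 n m) (hI : I.IsPure xorAndPred) (f : Fin m) : I.vars f 0 ≠ I.vars f 1 :=
  fun h => absurd (hI.2 f h) (by decide)

/-- On a pure instance an XOR pair has exactly two elements. -/
theorem card_xorPair (I : LocalMap 4 n m) (hI : I.IsPure xorAndPred) (f : Fin m) : (xorPair I f).card = 2 := by
  unfold xorPair
  exact card_pair (vars_zero_ne_one I hI f)

/-- On a pure instance an XOR-slot variable is not an AND-slot variable of the same output. -/
theorem xor_ne_and (I : LocalMap 4 n m) (hI : I.IsPure xorAndPred) (f : Fin m) {s t : Fin 4} (hs : s.val < 2) (ht : 2 ≤ t.val) :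
    I.vars f s ≠ I.vars f t := by
  intro h
  have := hI.2 f h
  subst this
  omega

/-- On a pure instance the XOR pair and the AND pair are disjoint. -/
theorem not_mem_andPair_of_mem_xorPair (I : LocalMap 4 n m) (hI : I.IsPure xorAndPred) (f : Fin m) {v : Fin n}
    (hv : v ∈ xorPair I f) : v ∉ andPair I f := by
  intro hva
  rw [mem_xorPair_iff] at hv
  rw [mem_andPair_iff] at hva
  rcases hv with rfl | rfl <;> rcases hva with h | h
  · exact xor_ne_and I hI f (s := 0) (t := 2) (by decide) (by decide) h
  · exact xor_ne_and I hI f (s := 0) (t := 3) (by decide) (by decide) h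
  · exact xor_ne_and I hI f (s := 1) (t := 2) (by decide) (by decide) h
  · exact xor_ne_and I hI f (s := 1) (t := 3) (by decide) (by decide) h

/-- **Simple overlaps**: two distinct outputs have distinct XOR pairs (on a pure instance). -/
theorem ne_of_xorPair_eq (I : LocalMap 4 n m) (hI : I.IsPure xorAndPred) (hS : SimpleOverlap I) {f f' : Fin m}
    (h : xorPair I f = xorPair I f') : f = f' := by
  by_contra hne
  have h0 : I.vars f 0 ∈ xorPair I f' := h ▸ (mem_xorPair_iff I f _).2 (Or.inl rfl)
  have h1 : I.vars f 1 ∈ xorPair I f' := h ▸ (mem_xorPair_iff I f _).2 (Or.inr rfl)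
  exact not_two_shared I hS hne (vars_zero_ne_one I hI f) (vars_mem_varSet I f 0) (xorPair_subset_varSet I f' h0)
    (vars_mem_varSet I f 1) (xorPair_subset_varSet I f' h1)

section Nor

variable (I : LocalMap 4 n m) (J₀ : Finset (Fin m)) [DecidablePred (IsChord I J₀)]

/-- The CENTRE EDGES of `J₀`: its non-chord outputs. -/
def cen : Finset (Fin m) := J₀.filter fun f => ¬ IsChord I J₀ f

/-- The CHORDS of `J₀` (both AND slots `J₀`-private). -/
def chd : Finset (Fin m) := J₀.filter (IsChord I J₀)

/-- The CLASS of `σ`: centre edges holding `σ` in an AND slot. -/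
def cls (σ : Fin n) : Finset (Fin m) := (cen I J₀).filter fun f => σ ∈ andPair I f

/-- The CENTRE DEGREE of a variable: the number of centre edges holding it in an XOR slot. -/
def cdeg (v : Fin n) : ℕ := ((cen I J₀).filter fun f => v ∈ xorPair I f).card

/-- The FOURTH variable of an output relative to `(σ, τ)`: the AND-slot variable other than the one in `{σ, τ}`. -/
def oth (σ τ : Fin n) (f : Fin m) : Fin n := if I.vars f 2 = σ ∨ I.vars f 2 = τ then I.vars f 3 else I.vars f 2

/-- Membership in `cen`. -/
theorem mem_cen {f : Fin m} : f ∈ cen I J₀ ↔ f ∈ J₀ ∧ ¬ IsChord I J₀ f := mem_filter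

/-- Membership in `chd`. -/
theorem mem_chd {f : Fin m} : f ∈ chd I J₀ ↔ f ∈ J₀ ∧ IsChord I J₀ f := mem_filter

/-- Centre edges are outputs of `J₀`. -/
theorem cen_subset : cen I J₀ ⊆ J₀ := filter_subset _ _

/-- Chords are outputs of `J₀`. -/
theorem chd_subset : chd I J₀ ⊆ J₀ := filter_subset _ _

/-- Membership in a class. -/
theorem mem_cls {σ : Fin n} {f : Fin m} : f ∈ cls I J₀ σ ↔ f ∈ cen I J₀ ∧ σ ∈ andPair I f := mem_filter

/-- A class consists of centre edges. -/
theorem cls_subset (σ : Fin n) : cls I J₀ σ ⊆ cen I J₀ := filter_subset _ _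

/-- `#cen + #chd = #J₀`. -/
theorem card_cen_add_card_chd : (cen I J₀).card + (chd I J₀).card = J₀.card := by
  unfold cen chd
  rw [add_comm]
  exact card_filter_add_card_filter_not _

/-- A centre edge and a chord differ. -/
theorem ne_of_mem_cen_of_mem_chd {f e : Fin m} (hf : f ∈ cen I J₀) (he : e ∈ chd I J₀) : f ≠ e := by
  rintro rfl
  exact ((mem_cen I J₀).1 hf).2 ((mem_chd I J₀).1 he).2

variable {I J₀}
variable (hI : I.IsPure xorAndPred) (hS : SimpleOverlap I) {σ τ : Fin n} {g₀ : Fin m} (hN : NorStructure I J₀ σ τ g₀)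
include hN

omit [DecidablePred (IsChord I J₀)] in
/-- `σ` and `τ` are variables of the reader `g₀`. -/
theorem sigma_mem_varSet_reader : σ ∈ varSet I g₀ ∧ τ ∈ varSet I g₀ := by
  rcases hN.2.2.1 with ⟨h2, h3⟩ | ⟨h2, h3⟩
  · exact ⟨h2 ▸ vars_mem_varSet I g₀ 2, h3 ▸ vars_mem_varSet I g₀ 3⟩
  · exact ⟨h3 ▸ vars_mem_varSet I g₀ 3, h2 ▸ vars_mem_varSet I g₀ 2⟩

omit [DecidablePred (IsChord I J₀)] in
/-- The NOR structure is symmetric in `(σ, τ)`. -/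
theorem norStructure_symm : NorStructure I J₀ τ σ g₀ := by
  obtain ⟨hne, hg, hpair, hcen, hch⟩ := hN
  refine ⟨hne.symm, hg, hpair.symm, fun f hf hc => ?_, hch⟩
  rcases hcen f hf hc with h | h | h | h
  · exact Or.inr (Or.inl h)
  · exact Or.inl h
  · exact Or.inr (Or.inr (Or.inr h))
  · exact Or.inr (Or.inr (Or.inl h))

include hS

omit [DecidablePred (IsChord I J₀)] in
/-- **Simple overlaps with the reader**: no output of `J₀` contains both `σ` and `τ`. -/
theorem not_both {f : Fin m} (hf : f ∈ J₀) : ¬ (σ ∈ varSet I f ∧ τ ∈ varSet I f) := by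
  rintro ⟨hσ, hτ⟩
  have hne : f ≠ g₀ := by rintro rfl; exact hN.2.1 hf
  obtain ⟨hσ₀, hτ₀⟩ := sigma_mem_varSet_reader hN
  exact not_two_shared I hS hne hN.1 hσ hσ₀ hτ hτ₀

omit hS in
/-- Every centre edge lies in the class of `σ` or in the class of `τ`. -/
theorem mem_cls_or {f : Fin m} (hf : f ∈ cen I J₀) : f ∈ cls I J₀ σ ∨ f ∈ cls I J₀ τ := by
  obtain ⟨hfJ, hfc⟩ := (mem_cen I J₀).1 hf
  rcases hN.2.2.2.1 f hfJ hfc with h | h | h | h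
  · exact Or.inl ((mem_cls I J₀).2 ⟨hf, h ▸ mem_andPair_of_slot I f 2 (by decide)⟩)
  · exact Or.inr ((mem_cls I J₀).2 ⟨hf, h ▸ mem_andPair_of_slot I f 2 (by decide)⟩)
  · exact Or.inl ((mem_cls I J₀).2 ⟨hf, h ▸ mem_andPair_of_slot I f 3 (by decide)⟩)
  · exact Or.inr ((mem_cls I J₀).2 ⟨hf, h ▸ mem_andPair_of_slot I f 3 (by decide)⟩)

/-- No centre edge lies in both classes. -/
theorem not_mem_cls_both {f : Fin m} (hσ : f ∈ cls I J₀ σ) (hτ : f ∈ cls I J₀ τ) : False := by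
  obtain ⟨hf, hσ'⟩ := (mem_cls I J₀).1 hσ
  obtain ⟨-, hτ'⟩ := (mem_cls I J₀).1 hτ
  exact not_both hS hN (cen_subset I J₀ hf) ⟨andPair_subset_varSet I f hσ', andPair_subset_varSet I f hτ'⟩

omit hN in
/-- **Classes are matchings**: two distinct edges of the class of `σ` share no variable other than `σ`. -/
theorem cls_share {f f' : Fin m} (hf : f ∈ cls I J₀ σ) (hf' : f' ∈ cls I J₀ σ) (hne : f ≠ f') {v : Fin n} (hvσ : v ≠ σ)
    (hv : v ∈ varSet I f) (hv' : v ∈ varSet I f') : False := by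
  obtain ⟨-, h1⟩ := (mem_cls I J₀).1 hf
  obtain ⟨-, h2⟩ := (mem_cls I J₀).1 hf'
  exact not_two_shared I hS hne hvσ hv hv' (andPair_subset_varSet I f h1) (andPair_subset_varSet I f' h2)

include hI

/-- An XOR variable of a centre edge is neither `σ` nor `τ`. -/
theorem xor_ne_sigma {f : Fin m} (hf : f ∈ cen I J₀) {v : Fin n} (hv : v ∈ xorPair I f) : v ≠ σ ∧ v ≠ τ := by
  have key : ∀ {ρ ρ' : Fin n}, f ∈ cls I J₀ ρ → (ρ' = ρ ∨ ¬ (ρ ∈ varSet I f ∧ ρ' ∈ varSet I f)) → v ≠ ρ' := by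
    intro ρ ρ' hρ h hv'
    subst hv'
    obtain ⟨-, hρa⟩ := (mem_cls I J₀).1 hρ
    rcases h with rfl | h
    · exact not_mem_andPair_of_mem_xorPair I hI f hv hρa
    · exact h ⟨andPair_subset_varSet I f hρa, xorPair_subset_varSet I f hv⟩
  have hfJ := cen_subset I J₀ hf
  rcases mem_cls_or hN hf with h | h
  · exact ⟨key h (Or.inl rfl), key h (Or.inr (not_both hS hN hfJ))⟩
  · refine ⟨key h (Or.inr fun h' => not_both hS hN hfJ ⟨h'.2, h'.1⟩), key h (Or.inl rfl)⟩

/-- **No XOR variable lies on three centre edges** (two of them would be in one class and share it besides the class variable). -/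
theorem cdeg_le_two (v : Fin n) : cdeg I J₀ v ≤ 2 := by
  classical
  by_contra h
  have h3 : 2 < ((cen I J₀).filter fun f => v ∈ xorPair I f).card := by unfold cdeg at h; omega
  obtain ⟨a, ha, b, hb, c, hc, hab, hac, hbc⟩ := two_lt_card.1 h3
  rw [mem_filter] at ha hb hc
  -- two of the three lie in one class
  have key : ∀ {f f' : Fin m}, f ∈ cen I J₀ → v ∈ xorPair I f → f' ∈ cen I J₀ → v ∈ xorPair I f' → f ≠ f' →
      ∀ ρ ∈ ({σ, τ} : Finset (Fin n)), f ∈ cls I J₀ ρ → f' ∈ cls I J₀ ρ → False := by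
    intro f f' hf hv hf' hv' hne ρ hρ h1 h2
    have hvρ : v ≠ ρ := by
      rw [mem_insert, mem_singleton] at hρ
      rcases hρ with rfl | rfl
      · exact (xor_ne_sigma hI hS hN hf hv).1
      · exact (xor_ne_sigma hI hS hN hf hv).2
    rw [mem_insert, mem_singleton] at hρ
    rcases hρ with rfl | rfl
    · exact cls_share hS h1 h2 hne hvρ (xorPair_subset_varSet I f hv) (xorPair_subset_varSet I f' hv')
    · exact cls_share hS h1 h2 hne hvρ (xorPair_subset_varSet I f hv) (xorPair_subset_varSet I f' hv')
  have hσm : σ ∈ ({σ, τ} : Finset (Fin n)) := mem_insert_self _ _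
  have hτm : τ ∈ ({σ, τ} : Finset (Fin n)) := mem_insert_of_mem (mem_singleton_self _)
  rcases mem_cls_or hN ha.1 with h1 | h1 <;> rcases mem_cls_or hN hb.1 with h2 | h2 <;>
    rcases mem_cls_or hN hc.1 with h4 | h4
  · exact key ha.1 ha.2 hb.1 hb.2 hab σ hσm h1 h2
  · exact key ha.1 ha.2 hb.1 hb.2 hab σ hσm h1 h2
  · exact key ha.1 ha.2 hc.1 hc.2 hac σ hσm h1 h4
  · exact key hb.1 hb.2 hc.1 hc.2 hbc τ hτm h2 h4
  · exact key hb.1 hb.2 hc.1 hc.2 hbc σ hσm h2 h4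
  · exact key ha.1 ha.2 hc.1 hc.2 hac τ hτm h1 h4
  · exact key ha.1 ha.2 hb.1 hb.2 hab τ hτm h1 h2
  · exact key ha.1 ha.2 hb.1 hb.2 hab τ hτm h1 h2

omit hI hS in
/-- The AND pair of a centre edge consists of its class variable and its fourth variable. -/
theorem andPair_subset_oth {f : Fin m} (hf : f ∈ cen I J₀) : andPair I f ⊆ {σ, τ, oth I σ τ f} := by
  intro v hv
  rw [mem_andPair_iff] at hv
  obtain ⟨hfJ, hfc⟩ := (mem_cen I J₀).1 hf
  have hslot := hN.2.2.2.1 f hfJ hfc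
  simp only [mem_insert, mem_singleton, oth]
  rcases hv with rfl | rfl
  · by_cases h : I.vars f 2 = σ ∨ I.vars f 2 = τ
    · rcases h with h | h
      · exact Or.inl h
      · exact Or.inr (Or.inl h)
    · rw [if_neg h]; exact Or.inr (Or.inr rfl)
  · by_cases h : I.vars f 2 = σ ∨ I.vars f 2 = τ
    · rw [if_pos h]; exact Or.inr (Or.inr rfl)
    · rw [if_neg h]
      push Not at h
      rcases hslot with h' | h' | h' | h'
      · exact absurd h' h.1
      · exact absurd h' h.2
      · exact Or.inl h'
      · exact Or.inr (Or.inl h')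

omit hI hS hN in
/-- Two edges in the class of `σ` make `σ` non-private in any family containing them. -/
theorem sigma_not_mem_bdry {X : Finset (Fin m)} (hX : cls I J₀ σ ⊆ X) (h2 : 2 ≤ (cls I J₀ σ).card) : σ ∉ bdry I X := by
  classical
  have h1 : 1 < (cls I J₀ σ).card := by omega
  obtain ⟨f, hf, f', hf', hne⟩ := one_lt_card.1 h1
  exact not_mem_bdry_of_two I (hX hf) (hX hf') hne (andPair_subset_varSet I f ((mem_cls I J₀).1 hf).2)
    (andPair_subset_varSet I f' ((mem_cls I J₀).1 hf').2)

/-! ## The handshake for centre degrees -/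

omit hS hN in
/-- `Σ_v cdeg v = 2·#cen`. -/
theorem sum_cdeg : ∑ v, cdeg I J₀ v = 2 * (cen I J₀).card := by
  classical
  unfold cdeg
  simp_rw [card_filter]
  rw [sum_comm]
  have : ∀ f ∈ cen I J₀, (∑ v : Fin n, if v ∈ xorPair I f then 1 else 0) = 2 := fun f _ => by
    rw [sum_boole, Nat.cast_id]
    have : (univ.filter fun v : Fin n => v ∈ xorPair I f) = xorPair I f := by ext v; simp
    rw [this, card_xorPair I hI f]
  rw [sum_congr rfl this, sum_const, smul_eq_mul, mul_comm]

/-- **Handshake**: `2·#cen = η + 2ι` with `η`, `ι` the numbers of XOR variables of centre degree `1`, `2`. -/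
theorem two_mul_card_cen : 2 * (cen I J₀).card =
    (univ.filter fun v => cdeg I J₀ v = 1).card + 2 * (univ.filter fun v => cdeg I J₀ v = 2).card := by
  classical
  rw [← sum_cdeg hI]
  have hpt : ∀ v : Fin n, cdeg I J₀ v = (if cdeg I J₀ v = 1 then 1 else 0) + 2 * (if cdeg I J₀ v = 2 then 1 else 0) := by
    intro v
    have := cdeg_le_two hI hS hN v
    interval_cases cdeg I J₀ v <;> simp
  rw [sum_congr rfl fun v _ => hpt v, sum_add_distrib, ← mul_sum, sum_boole, sum_boole, Nat.cast_id, Nat.cast_id]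

/-- A vertex of centre degree `2` lies on an edge of the class of `σ` (its two centre edges are in different classes). -/
theorem exists_cls_of_cdeg_two {v : Fin n} (hv : cdeg I J₀ v = 2) : ∃ f ∈ cls I J₀ σ, v ∈ xorPair I f := by
  classical
  unfold cdeg at hv
  obtain ⟨f, f', hne, hff⟩ := card_eq_two.1 hv
  have hf : f ∈ (cen I J₀).filter fun f => v ∈ xorPair I f := hff ▸ mem_insert_self _ _
  have hf' : f' ∈ (cen I J₀).filter fun f => v ∈ xorPair I f := hff ▸ mem_insert_of_mem (mem_singleton_self _)
  rw [mem_filter] at hf hf'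
  rcases mem_cls_or hN hf.1 with h | h
  · exact ⟨f, h, hf.2⟩
  rcases mem_cls_or hN hf'.1 with h' | h'
  · exact ⟨f', h', hf'.2⟩
  exact absurd (cls_share hS h h' hne (xor_ne_sigma hI hS hN hf.1 hf.2).2
    (xorPair_subset_varSet I f hf.2) (xorPair_subset_varSet I f' hf'.2)) id

/-- **`ι ≤ 2·#cls σ`**: the vertices of centre degree `2` are covered by the XOR pairs of the class of `σ`. -/
theorem iota_le : (univ.filter fun v => cdeg I J₀ v = 2).card ≤ 2 * (cls I J₀ σ).card := by
  classical
  have hcov : (univ.filter fun v => cdeg I J₀ v = 2) ⊆ (cls I J₀ σ).biUnion (xorPair I) := by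
    intro v hv
    rw [mem_filter] at hv
    obtain ⟨f, hf, hvf⟩ := exists_cls_of_cdeg_two hI hS hN hv.2
    exact mem_biUnion.2 ⟨f, hf, hvf⟩
  calc (univ.filter fun v => cdeg I J₀ v = 2).card ≤ ((cls I J₀ σ).biUnion (xorPair I)).card := card_le_card hcov
    _ ≤ ∑ f ∈ cls I J₀ σ, (xorPair I f).card := card_biUnion_le
    _ ≤ ∑ _f ∈ cls I J₀ σ, 2 := sum_le_sum fun f _ => card_xorPair_le I f
    _ = 2 * (cls I J₀ σ).card := by rw [sum_const, smul_eq_mul, mul_comm]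

end Nor

end Summit.PneNP.PneNP.Theorems.PstarNorCoreTools
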